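import Summits.Schanuel.Schanuel.Theorems.RootDecomp1KArcCell01

/-!
# RootDecomp1KArcCell — lens 1, generation 50, node 9 «THE ARC ENGINE: separation by positive-dimensional containment; members ρ° = Π(1+4^(−k!)) and the twin σ° = Π(1+2·4^(−k!)); item 33364 decided hyp-free at zA = (1, ℓ₂, ρ°), zD = (1, ρ°, σ°) and π-twins» — continuation (RootDecomp1KArcCell02): §3 (A) the member ρ° = Π(1+4^(−k!)) and its tails

(lens-1 g50 HOME kernel K = HOME/decomp-schanuel-lens-1/g50/ArcCell.lean 10f1e0d5…, 3410 l · 258 decl lines, imports …RootDecomp1KCollarWall05 + …RootDecomp1KCommonRadixCell04 + …RootDecomp1KNWMeasureHolds BY NAME; P ArcCellProbe.lean af7624ff… rc 0 / C₀ ArcCellCtrl0.lean d71f613e… rc 0 / C ArcCellCtrl.lean 242a3b02… rc 1 = 42 planted; memo NODE-g50.md; CLAIM L2466, EX-ANTE PRICE + CHECKLIST K-g50 L2467, NODE L2469 / REQUEST L2470 (with the lens's ex-post self-correction: both members fall to printed dominance in substance — zA directly by Bundschuh LNM 1415 p.78 / Zhu 推论 1.3.3, zD after τ = σ°/ρ°²);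 critic VERDICT L2473: CLEARED AS PRICED EX ANTE — ONE CELL ×1 «ARC CELL (TYPED-LEVEL)» with the SUBSTANCE CAVEAT OF RECORD (both members inside the archimedean dominance class in substance; E2 convenient, not necessary), RULE K-R39 FIXED, PORT GO. Port by census-1 gen 21 as `RootDecomp1KArcCell01–13` along K's §1–§12 with §4, §7 and §12 cut at decl boundaries by the 400-line file cap: 01 = §1 (E1) `aeval_one_div_two_pow_ne_zero` (dyadic root lemma) + §2 (E2) `toPolyPoly`, `arc_count` (a relation contains ≤ deg q of an injective family of rational arcs — roots over the domain ℚ[X]); 02 = §3 (A) the member: `dfac`, `arcNum`, `arcProdQ` (ρ°_N), `sQ`, `rhoArc` (ρ° = Π(1 + 4^(−k!))) and its tails; 03 = §4a (E3) `TruncGenericSeq` («[class] definition» tag) + **`algebraicIndependent_of_truncGenericSeq`** (the g36/g37 extraction re-plumbed to arbitrary dyadic-type schedules); 04 = §4b `psQ`, the link `truncGeneric_iff_truncGenericSeq` and the tree (X′) re-derived — K's `theorem algebraicIndependent_liouville_of_truncGeneric'` DEMOTED to a documented `example` (its statement is byte-identical to the tree's `RootDecomp1KCommonRadixCell.algebraicIndependent_liouville_of_truncGeneric`,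 CommonRadixCell03 l.98 — dedup twin flagged by the writer L2472 (α), demotion pre-sanctioned by the critic L2473; nothing in K uses the primed name); 05 = §5 the arcs of ρ°: `arcPoly`, `arcF`, `arcBasis`, `arcScal`, `clearArc`, `truncGenericSeq_arc`, tightness `qArc` / `qArc_tight`; 06 = §6 the arc cell `algebraicIndependent_arc_of_mvPolyMeasure`, `algebraicIndependent_rhoArc_ell2`, walls `sb_arcWall3(_pi)`, item-shape instances + §7 head `zA` / `zApi`, `linearIndependent_zA(pi)`, `linLiouville_zA(pi)`; 07 = §7a the ONE 2-adic cut `cutA` + **`form_lower_bound_A`** (exponent 9), `not_hyperLinLiouville_zA(pi)` (m₀ = 10), `sb_zA(pi)`, `finiteOrderLiouvilleSchanuel_at_zA(pi)`, `item33364_at_zA(pi)`, `item31077_at_zA`; 08 = §8 `rhoArc_position` (11 conjuncts by tree name) and its lemmas, `liouville_rhoArc`; 09 = §9 (A′) the twin σ° = Π(1 + 2·4^(−k!)): `arcNum2`, `arcOdd2`, `arcProdQ2`, `sigmaArc`, `liouville_sigmaArc`; 10 = §10 the lines of (ρ°, σ°): `linPoly`, `linF`, `linBasis`, `linScal`, `clearLin`,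 `truncGenericSeq_lin`, `qLin` / `qLin_tight`; 11 = §11 the twin cell `algebraicIndependent_twin_of_mvPolyMeasure`, walls `sb_twinWall3(_pi)`, item-shape instances + §12 head `zD` / `zDpi`, binders; 12 = §12a part 1 the archimedean two-level cut `cutD`, `cutD_succ_ne_zero`, `cutD_height_bound`; 13 = §12a part 2 **`form_lower_bound_D`** (exponent 7), `not_hyperLinLiouville_zD(pi)` (m₀ = 8), `sb_zD(pi)`, `item33364_at_zD(pi)`, `zD_shape`. PORT EDITS (census convention): `set_option linter.dupNamespace false` dropped; 77 one-line helper docstrings added (statements quoted); per-part private helper copies; sections `Extraction` / `Members` / `TwinMembers` closed and re-opened across the cuts with their `variable` / `open` lines; statements and proofs otherwise verbatim (no renames; K's own private markers kept). `--supports stmt-Schanuel-33364`; no census credit carried; rung 0 — nothing here proves Schanuel; no ∀-item moves; 33364, 33363, 31077 stay OPEN.)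
-/

noncomputable section

open Polynomial LiouvilleNumber
open scoped Nat

namespace Summit.Schanuel.Schanuel.Theorems.RootDecomp1KArcCell

open Summit.Schanuel.Schanuel.Theorems.RootDecomp1KCollarCell
open Summit.Schanuel.Schanuel.Theorems.RootDecomp1KGapCell
open Summit.Schanuel.Schanuel.Theorems.RootDecomp1KTwoBaseCell
open Summit.Schanuel.Schanuel.Theorems.RootDecomp1KRelLiouvilleCell
open Summit.Schanuel.Schanuel.Theorems.RootDecomp1KNWMeasureHolds (polyMeasure_exp_one_holds)
open Summit.Schanuel.Schanuel.Theorems.RootDecomp1KHyper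
open Summit.Schanuel.Schanuel.Theorems.RootDecomp1KHyper.HyperCell
open Summit.Schanuel.Schanuel.Theorems.RootDecomp1KCommonRadixCell (TruncGeneric algebraicIndependent_liouville_of_truncGeneric)

/-! ## §3  (A) THE MEMBER — the Euler product `ρ° = Π_{k ≥ 0} (1 + 4^{-k!})` over the skeleton of `ℓ₂` -/
section Member

/-- `D_N = Σ_{k ≤ N} k!`: the partial product `ρ°_N` has denominator exactly `4^{D_N} = 2^{2 D_N}`. -/
def dfac (N : ℕ) : ℕ := ∑ k ∈ Finset.range (N + 1), k !

/-- `dfac 0 = 1`. -/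
theorem dfac_zero : dfac 0 = 1 := by simp [dfac]

/-- `(N : ℕ) : dfac (N + 1) = dfac N + (N + 1)!`. -/
theorem dfac_succ (N : ℕ) : dfac (N + 1) = dfac N + (N + 1)! := by
  simp only [dfac, Finset.sum_range_succ]

/-- `(N : ℕ) : N ! ≤ dfac N`. -/
theorem factorial_le_dfac (N : ℕ) : N ! ≤ dfac N := by
  unfold dfac
  rw [Finset.sum_range_succ]
  exact Nat.le_add_left _ _

/-- `(N : ℕ) : 0 < dfac N`. -/
theorem dfac_pos (N : ℕ) : 0 < dfac N := lt_of_lt_of_le (Nat.factorial_pos N) (factorial_le_dfac N)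

/-- `D_N ≤ 2 · N!`. -/
theorem dfac_le (N : ℕ) : dfac N ≤ 2 * N ! := by
  induction N with
  | zero => simp [dfac]
  | succ n ih =>
    rw [dfac_succ, Nat.factorial_succ]
    rcases Nat.eq_zero_or_pos n with rfl | hn
    · simp [dfac]
    · nlinarith [Nat.factorial_pos n]

/-- `2 D_N ≤ (N+1)!` for `N ≥ 3`. -/
theorem two_dfac_le_factorial_succ {N : ℕ} (hN : 3 ≤ N) : 2 * dfac N ≤ (N + 1)! := by
  have h := dfac_le N
  rw [Nat.factorial_succ]
  nlinarith [Nat.factorial_pos N]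

/-- The odd numerator `Π_{k ≤ N} (4^{k!} + 1)` of `ρ°_N`. -/
def arcNum (N : ℕ) : ℕ := ∏ k ∈ Finset.range (N + 1), (4 ^ k ! + 1)

/-- `arcNum 0 = 5`. -/
theorem arcNum_zero : arcNum 0 = 5 := by simp [arcNum]

/-- `(N : ℕ) : arcNum (N + 1) = arcNum N * (4 ^ (N + 1)! + 1)`. -/
theorem arcNum_succ (N : ℕ) : arcNum (N + 1) = arcNum N * (4 ^ (N + 1)! + 1) := by
  simp only [arcNum, Finset.prod_range_succ]

/-- `(N : ℕ) : Odd (arcNum N)`. -/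
theorem odd_arcNum (N : ℕ) : Odd (arcNum N) := by
  induction N with
  | zero => rw [arcNum_zero]; exact ⟨2, by norm_num⟩
  | succ n ih =>
    rw [arcNum_succ]
    refine ih.mul (Even.add_one ?_)
    exact (Nat.even_pow).mpr ⟨⟨2, by norm_num⟩, (Nat.factorial_pos _).ne'⟩

/-- **The partial products** `ρ°_N = Π_{k ≤ N} (1 + 4^{-k!}) ∈ ℚ` (the level-`N` approximant of the member). -/
def arcProdQ (N : ℕ) : ℚ := ∏ k ∈ Finset.range (N + 1), (1 + 1 / 4 ^ k !)

/-- `arcProdQ 0 = 5 / 4`. -/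
theorem arcProdQ_zero : arcProdQ 0 = 5 / 4 := by norm_num [arcProdQ]

/-- THE RECURSION ALONG THE ARC: `ρ°_{N+1} = ρ°_N · (1 + u_{N+1}²)`, `u_{N+1} = 2^{-(N+1)!}`. -/
theorem arcProdQ_succ (N : ℕ) : arcProdQ (N + 1) = arcProdQ N * (1 + 1 / 4 ^ (N + 1)!) := by
  simp only [arcProdQ, Finset.prod_range_succ]

/-- `(N : ℕ) : arcProdQ N = (arcNum N : ℚ) / 4 ^ dfac N`. -/
theorem arcProdQ_eq_div (N : ℕ) : arcProdQ N = (arcNum N : ℚ) / 4 ^ dfac N := by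
  induction N with
  | zero => rw [arcProdQ_zero, arcNum_zero, dfac_zero]; norm_num
  | succ n ih =>
    rw [arcProdQ_succ, ih, arcNum_succ, dfac_succ, pow_add]
    have h4 : (4 : ℚ) ^ dfac n ≠ 0 := pow_ne_zero _ (by norm_num)
    have h4' : (4 : ℚ) ^ (n + 1)! ≠ 0 := pow_ne_zero _ (by norm_num)
    push_cast
    field_simp

/-- `(N : ℕ) : 0 < arcProdQ N`. -/
theorem arcProdQ_pos (N : ℕ) : 0 < arcProdQ N :=
  Finset.prod_pos fun k _ => by positivity

/-- `(N : ℕ) : arcProdQ N < arcProdQ (N + 1)`. -/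
theorem arcProdQ_lt_succ (N : ℕ) : arcProdQ N < arcProdQ (N + 1) := by
  rw [arcProdQ_succ]
  have h1 : (1 : ℚ) < 1 + 1 / 4 ^ (N + 1)! := by
    have : (0 : ℚ) < 1 / 4 ^ (N + 1)! := by positivity
    linarith
  exact lt_mul_of_one_lt_right (arcProdQ_pos N) h1

/-- `StrictMono arcProdQ`. -/
theorem arcProdQ_strictMono : StrictMono arcProdQ := strictMono_nat_of_lt_succ arcProdQ_lt_succ

/-- `Monotone arcProdQ`. -/
theorem arcProdQ_mono : Monotone arcProdQ := arcProdQ_strictMono.monotone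

/-- `ρ°_N ≥ 5/4`, and `ρ°_N > 3/2` from `N = 1` on (`ρ°_1 = 25/16`). -/
theorem five_fourths_le_arcProdQ (N : ℕ) : 5 / 4 ≤ arcProdQ N := by
  rw [← arcProdQ_zero]; exact arcProdQ_mono (Nat.zero_le N)

/-- `arcProdQ 1 = 25 / 16`. -/
theorem arcProdQ_one : arcProdQ 1 = 25 / 16 := by
  rw [arcProdQ_succ, arcProdQ_zero]; norm_num

/-- `{N : ℕ} (hN : 1 ≤ N) : 3 / 2 < arcProdQ N`. -/
theorem three_halves_lt_arcProdQ {N : ℕ} (hN : 1 ≤ N) : 3 / 2 < arcProdQ N := by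
  have h := arcProdQ_mono hN
  rw [arcProdQ_one] at h
  linarith

/-- EXACT DENOMINATOR: `den ρ°_N = 4^{D_N}` (the numerator `arcNum N` is odd). -/
theorem den_arcProdQ (N : ℕ) : (arcProdQ N).den = 4 ^ dfac N := by
  have hcop : Nat.Coprime ((arcNum N : ℤ)).natAbs (((4 : ℤ) ^ dfac N)).natAbs := by
    rw [Int.natAbs_natCast, Int.natAbs_pow]
    have h2 : Nat.Coprime (arcNum N) 2 := (Nat.coprime_two_right).mpr (odd_arcNum N)
    have h4 : Nat.Coprime (arcNum N) 4 := by
      rw [show (4 : ℕ) = 2 ^ 2 by norm_num]; exact h2.pow_right 2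
    exact h4.pow_right (dfac N)
  have h := Rat.den_div_eq_of_coprime (a := (arcNum N : ℤ)) (b := (4 : ℤ) ^ dfac N) (by positivity) hcop
  have e : (((arcNum N : ℤ) : ℚ) / (((4 : ℤ) ^ dfac N : ℤ) : ℚ)) = arcProdQ N := by
    rw [arcProdQ_eq_div]; push_cast; rfl
  rw [e] at h
  exact_mod_cast h

/-- `(N : ℕ) : (arcProdQ N).den = 2 ^ (2 * dfac N)`. -/
theorem den_arcProdQ_eq_two_pow (N : ℕ) : (arcProdQ N).den = 2 ^ (2 * dfac N) := by
  rw [den_arcProdQ, pow_mul]; norm_num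

/-- `ρ°_N · 4^{D_N} = arcNum N` (an odd integer). -/
theorem arcProdQ_mul_den (N : ℕ) : arcProdQ N * 4 ^ dfac N = arcNum N := by
  rw [arcProdQ_eq_div, div_mul_cancel₀ _ (pow_ne_zero _ (by norm_num))]

/-- The level-`N` approximant of `ℓ₂` as a rational: `s_N = psNumer 2 N / 2^{N!}`. -/
def sQ (N : ℕ) : ℚ := (psNumer 2 N : ℚ) / 2 ^ N !

/-- `(N : ℕ) : ((sQ N : ℚ) : ℝ) = partialSum 2 N`. -/
theorem sQ_cast (N : ℕ) : ((sQ N : ℚ) : ℝ) = partialSum 2 N := by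
  have h := partialSum_eq_psNumer_div (b := 2) (by norm_num) N
  push_cast at h
  rw [h, sQ]; push_cast; rfl

/-- THE RECURSION ALONG THE ARC: `s_{N+1} = s_N + u_{N+1}`. -/
theorem sQ_succ (N : ℕ) : sQ (N + 1) = sQ N + 1 / 2 ^ (N + 1)! := by
  have h : ((sQ (N + 1) : ℚ) : ℝ) = ((sQ N + 1 / 2 ^ (N + 1)! : ℚ) : ℝ) := by
    push_cast
    rw [sQ_cast, sQ_cast, partialSum_succ]
  exact_mod_cast h

/-- `(N : ℕ) : 0 < sQ N`. -/
theorem sQ_pos (N : ℕ) : 0 < sQ N := by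
  have h : (0 : ℝ) < ((sQ N : ℚ) : ℝ) := by rw [sQ_cast]; exact partialSum_pos' (by norm_num) N
  exact_mod_cast h

/-- `(N : ℕ) : sQ N < 2`. -/
theorem sQ_lt_two (N : ℕ) : sQ N < 2 := by
  have h : ((sQ N : ℚ) : ℝ) < 2 := by rw [sQ_cast]; exact partialSum_lt_two (by norm_num) N
  exact_mod_cast h

/-- `(N : ℕ) : sQ N * 2 ^ N ! = psNumer 2 N`. -/
theorem sQ_mul_den (N : ℕ) : sQ N * 2 ^ N ! = psNumer 2 N := by
  rw [sQ, div_mul_cancel₀ _ (pow_ne_zero _ two_ne_zero)]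

/-- `(N : ℕ) : ((sQ N).den : ℤ) ∣ 2 ^ N !`. -/
theorem den_sQ_dvd (N : ℕ) : ((sQ N).den : ℤ) ∣ 2 ^ N ! := by
  have h := Rat.den_dvd (psNumer 2 N : ℤ) ((2 : ℤ) ^ N !)
  rw [Rat.divInt_eq_div] at h
  have e : ((psNumer 2 N : ℤ) : ℚ) / (((2 : ℤ) ^ N ! : ℤ) : ℚ) = sQ N := by rw [sQ]; push_cast; rfl
  rwa [e] at h

/-- `(N : ℕ) : ((arcProdQ N).den : ℤ) ∣ 2 ^ (2 * dfac N)`. -/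
theorem den_arcProdQ_dvd (N : ℕ) : ((arcProdQ N).den : ℤ) ∣ 2 ^ (2 * dfac N) := by
  rw [den_arcProdQ_eq_two_pow]; push_cast; exact dvd_rfl

/-! ### The real number `ρ°` and its tails -/

/-- `Π (1 + x_k) ≤ 1 + 2 Σ x_k` for non-negative `x_k` with `Σ x_k ≤ 1/2`. -/
theorem prod_one_add_le {ι : Type*} (s : Finset ι) (x : ι → ℝ) (hx : ∀ k, 0 ≤ x k)
    (hs : ∑ k ∈ s, x k ≤ 1 / 2) : ∏ k ∈ s, (1 + x k) ≤ 1 + 2 * ∑ k ∈ s, x k := by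
  classical
  induction s using Finset.induction_on with
  | empty => simp
  | insert a s ha ih =>
    rw [Finset.sum_insert ha] at hs ⊢
    rw [Finset.prod_insert ha]
    have hA : 0 ≤ ∑ k ∈ s, x k := Finset.sum_nonneg fun k _ => hx k
    have ih' := ih (by linarith [hx a])
    have hP : 0 ≤ ∏ k ∈ s, (1 + x k) := Finset.prod_nonneg fun k _ => by linarith [hx k]
    nlinarith [hx a, mul_le_mul_of_nonneg_left ih' (by linarith [hx a] : (0:ℝ) ≤ 1 + x a)]

/-- The skeleton tail: `Σ_{N < k ≤ M} 4^{-k!} ≤ (4/3) · 4^{-(N+1)!}`. -/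
theorem sum_Ioc_inv_four_pow_le (N M : ℕ) :
    ∑ k ∈ Finset.Ioc N M, (1 : ℝ) / 4 ^ k ! ≤ 4 / 3 / 4 ^ (N + 1)! := by
  have himg : Finset.Ioc N M = (Finset.range (M - N)).image (fun j => j + (N + 1)) := by
    ext k
    simp only [Finset.mem_Ioc, Finset.mem_image, Finset.mem_range]
    constructor
    · intro hk; exact ⟨k - (N + 1), by omega, by omega⟩
    · rintro ⟨j, hj, rfl⟩; omega
  have h1 : ∑ k ∈ Finset.Ioc N M, (1 : ℝ) / 4 ^ k ! =
      ∑ j ∈ Finset.range (M - N), 1 / (4 : ℝ) ^ (j + (N + 1))! := by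
    rw [himg, Finset.sum_image (fun a _ b _ h => by simpa using h)]
  rw [h1]
  have hsum := remainder_summable (m := (4 : ℝ)) (by norm_num) N
  have h2 : ∑ j ∈ Finset.range (M - N), 1 / (4 : ℝ) ^ (j + (N + 1))! ≤ remainder 4 N :=
    hsum.sum_le_tsum _ (fun k _ => by positivity)
  refine h2.trans ?_
  have h3 := remainder_lt' N (m := (4 : ℝ)) (by norm_num)
  have e : (1 - 1 / (4 : ℝ))⁻¹ * (1 / 4 ^ (N + 1)!) = 4 / 3 / 4 ^ (N + 1)! := by
    norm_num [div_eq_mul_inv]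
  rw [e] at h3
  exact h3.le

/-- Along the skeleton the partial products barely move: `ρ°_M ≤ ρ°_N (1 + (8/3) 4^{-(N+1)!})` for `M ≥ N`. -/
theorem arcProdQ_le_of_le {N M : ℕ} (h : N ≤ M) :
    (arcProdQ M : ℝ) ≤ arcProdQ N * (1 + 8 / 3 / 4 ^ (N + 1)!) := by
  have hsplit : (arcProdQ M : ℝ) = arcProdQ N * ∏ k ∈ Finset.Ioc N M, (1 + (1 : ℝ) / 4 ^ k !) := by
    unfold arcProdQ
    push_cast
    have : Finset.range (M + 1) = Finset.range (N + 1) ∪ Finset.Ioc N M := by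
      ext k; simp [Finset.mem_range, Finset.mem_Ioc]; omega
    rw [this, Finset.prod_union]
    exact Finset.disjoint_left.mpr fun k hk hk' => by
      simp [Finset.mem_range, Finset.mem_Ioc] at hk hk'; omega
  rw [hsplit]
  have hpos : (0 : ℝ) < arcProdQ N := by exact_mod_cast arcProdQ_pos N
  refine mul_le_mul_of_nonneg_left ?_ hpos.le
  have htail := sum_Ioc_inv_four_pow_le N M
  have hhalf : ∑ k ∈ Finset.Ioc N M, (1 : ℝ) / 4 ^ k ! ≤ 1 / 2 := by
    refine htail.trans ?_
    have : (4 : ℝ) ≤ 4 ^ (N + 1)! := by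
      calc (4 : ℝ) = 4 ^ 1 := by norm_num
        _ ≤ 4 ^ (N + 1)! := pow_le_pow_right₀ (by norm_num) (Nat.factorial_pos _)
    rw [div_le_iff₀ (by positivity)]
    nlinarith
  have hprod := prod_one_add_le (Finset.Ioc N M) (fun k => (1 : ℝ) / 4 ^ k !) (fun k => by positivity) hhalf
  refine hprod.trans ?_
  have : 2 * ∑ k ∈ Finset.Ioc N M, (1 : ℝ) / 4 ^ k ! ≤ 8 / 3 / 4 ^ (N + 1)! := by
    have := mul_le_mul_of_nonneg_left htail (by norm_num : (0 : ℝ) ≤ 2)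
    refine this.trans (le_of_eq ?_)
    ring
  linarith

/-- A uniform bound: `ρ°_M ≤ 25/12 · … < 3`. -/
theorem arcProdQ_lt_three (M : ℕ) : (arcProdQ M : ℝ) < 3 := by
  have h := arcProdQ_le_of_le (Nat.zero_le M)
  rw [arcProdQ_zero] at h
  have : (1 : ℝ) + 8 / 3 / 4 ^ (0 + 1)! = 5 / 3 := by norm_num
  rw [this] at h
  push_cast at h
  linarith

/-- `(M : ℕ) : arcProdQ M < 3`. -/
theorem arcProdQ_lt_three' (M : ℕ) : arcProdQ M < 3 := by exact_mod_cast arcProdQ_lt_three M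

/-- **THE MEMBER** `ρ° := sup_N ρ°_N = Π_{k ≥ 0} (1 + 4^{-k!})` — the Euler product over the skeleton
`{2^{-k!}}` of `ℓ₂` with the quadratic local factor `φ(T) = 1 + T²`. -/
def rhoArc : ℝ := ⨆ N : ℕ, (arcProdQ N : ℝ)

/-- The partial products `(ρ°_N)` are bounded above (in `ℝ`). -/
theorem bddAbove_arcProdQ : BddAbove (Set.range fun N : ℕ => (arcProdQ N : ℝ)) :=
  ⟨3, by rintro _ ⟨N, rfl⟩; exact (arcProdQ_lt_three N).le⟩

/-- `(N : ℕ) : (arcProdQ N : ℝ) ≤ rhoArc`. -/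
theorem arcProdQ_le_rhoArc (N : ℕ) : (arcProdQ N : ℝ) ≤ rhoArc :=
  le_ciSup bddAbove_arcProdQ N

/-- UPPER TAIL: `ρ° ≤ ρ°_N (1 + (8/3) 4^{-(N+1)!})`. -/
theorem rhoArc_le (N : ℕ) : rhoArc ≤ arcProdQ N * (1 + 8 / 3 / 4 ^ (N + 1)!) := by
  refine ciSup_le fun M => ?_
  rcases le_or_gt N M with h | h
  · exact arcProdQ_le_of_le h
  · have h1 : (arcProdQ M : ℝ) ≤ arcProdQ N := by exact_mod_cast arcProdQ_mono h.le
    have h2 : (0 : ℝ) ≤ arcProdQ N * (8 / 3 / 4 ^ (N + 1)!) :=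
      mul_nonneg (by exact_mod_cast (arcProdQ_pos N).le) (by positivity)
    linarith

/-- `0 < rhoArc`. -/
theorem rhoArc_pos : 0 < rhoArc :=
  lt_of_lt_of_le (by exact_mod_cast arcProdQ_pos 0) (arcProdQ_le_rhoArc 0)

/-- `3 / 2 < rhoArc`. -/
theorem three_halves_lt_rhoArc : 3 / 2 < rhoArc := by
  have h := (Rat.cast_lt (K := ℝ)).mpr (three_halves_lt_arcProdQ (le_refl 1))
  push_cast at h
  exact lt_of_lt_of_le h (arcProdQ_le_rhoArc 1)

/-- `rhoArc < 3`. -/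
theorem rhoArc_lt_three : rhoArc < 3 := by
  have h := rhoArc_le 1
  rw [arcProdQ_one] at h
  have : (8 : ℝ) / 3 / 4 ^ (1 + 1)! = 1 / 6 := by norm_num
  rw [this] at h
  push_cast at h
  linarith

/-- LOWER TAIL (exact to leading order): `ρ° − ρ°_N ≥ ρ°_N · 4^{-(N+1)!} ≥ 4^{-(N+1)!}`. -/
theorem rhoArc_sub_arcProdQ_ge (N : ℕ) : 1 / 4 ^ (N + 1)! ≤ rhoArc - arcProdQ N := by
  have h1 := arcProdQ_le_rhoArc (N + 1)
  rw [arcProdQ_succ] at h1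
  push_cast at h1
  have h54 : (5 : ℝ) / 4 ≤ arcProdQ N := by
    have h := (Rat.cast_le (K := ℝ)).mpr (five_fourths_le_arcProdQ N)
    push_cast at h
    exact h
  have hpos : (0 : ℝ) < 1 / 4 ^ (N + 1)! := by positivity
  nlinarith

/-- UPPER TAIL in closed form: `ρ° − ρ°_N ≤ 8 · 4^{-(N+1)!}`. -/
theorem rhoArc_sub_arcProdQ_le (N : ℕ) : rhoArc - arcProdQ N ≤ 8 / 4 ^ (N + 1)! := by
  have h := rhoArc_le N
  have h3 := arcProdQ_lt_three N
  have hpos : (0 : ℝ) ≤ 8 / 3 / 4 ^ (N + 1)! := by positivity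
  rw [mul_add, mul_one] at h
  have h4 : (arcProdQ N : ℝ) * (8 / 3 / 4 ^ (N + 1)!) ≤ 3 * (8 / 3 / 4 ^ (N + 1)!) :=
    mul_le_mul_of_nonneg_right h3.le hpos
  have e : (3 : ℝ) * (8 / 3 / 4 ^ (N + 1)!) = 8 / 4 ^ (N + 1)! := by ring
  linarith

/-- `(N : ℕ) : (arcProdQ N : ℝ) < rhoArc`. -/
theorem arcProdQ_lt_rhoArc (N : ℕ) : (arcProdQ N : ℝ) < rhoArc := by
  have := rhoArc_sub_arcProdQ_ge N
  have hpos : (0 : ℝ) < 1 / 4 ^ (N + 1)! := by positivity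
  linarith

/-- `(N : ℕ) : rhoArc ≠ arcProdQ N`. -/
theorem rhoArc_ne_arcProdQ (N : ℕ) : rhoArc ≠ arcProdQ N := (arcProdQ_lt_rhoArc N).ne'

/-- `|ρ° − ρ°_N| ≤ 8 / 2^{(N+1)!}` — the dyadic-precision form used by the extraction. -/
theorem abs_rhoArc_sub_arcProdQ_le (N : ℕ) : |rhoArc - arcProdQ N| ≤ 8 / 2 ^ (N + 1)! := by
  rw [abs_of_pos (by linarith [arcProdQ_lt_rhoArc N])]
  refine (rhoArc_sub_arcProdQ_le N).trans ?_
  exact div_le_div_of_nonneg_left (by norm_num) (by positivity)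
    (pow_le_pow_left₀ (by norm_num) (by norm_num) _)

end Member

end Summit.Schanuel.Schanuel.Theorems.RootDecomp1KArcCell

end
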